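import Summits.ResolutionOfSingularities.ResolutionOfSingularities.Theorems.PurelyInseparableDim4PureLeafNormalForms
import Mathlib.FieldTheory.Finite.Basic
import HarnessLib
import HarnessLib.Audit.Tags

/-!
# Purely inseparable fourfolds — SPLIT NORMAL FORMS `∏ᵢ ∏_{c ∈ 𝔽_p} (xᵢ + c)^{m i c}` for the pure-leaf game over `𝔽_p`
# (cell res-dim4-pi; D3c kit E of `HOME/res-dim4-p-10/D3c-PAPER.md` §1/§5: p-10 g2's kit 3 generalised from `𝔽₂` to `𝔽_p`)
# [OURS · counted 0 · bookkeeping identities of OUR frame, not about resolution]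

Width seat `res-dim4-p-10` (g3).  The conjectured class of the paper proof «every pure leaf `x^a` wins the plain GLOBAL game
over `𝔽_p` at `q = p`, every prime `p`» (D3c; kernel at `p = 2`: `…PureLeafGlobalWinTheorem`) is built from SPLIT
univariate factors.  This file is the bookkeeping of the split normal form
`N(m) = ∏ᵢ ∏_{c : ZMod p} (Xᵢ + C c)^{m i c}` (written out in every statement; no definition), `m : σ → ZMod p → ℕ`:

* §1 structure (any commutative ring / `ZMod p`): the factors have disjoint variables (`apply_eq_zero_of_mem_support_linearFactors`),
  `N(m) = x^{m(·,0)} · (unit part)` with the unit part's constant coefficient `∏∏ c^{m i c} ≠ 0`, hence `coeff_{m(·,0)} N = that`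
  and `x^{m(·,0)}` divides `N` monomialwise — so `ord_{(x_S)} N(m) = Σ_{i∈S} m i 0`;
* §2 translation by an `𝔽_p`-point SHIFTS THE ROOTS: `translate b N(m) = N(m′)`, `m′ i c = m i (c − bᵢ)` (`translate_splitForm`);
* §3 Fermat: `(Xᵢ + C c)^{p·k} = expand p ((Xᵢ + C c)^k)`, so `N(m) = expand p N(m / p) · N(m % p)` (`splitForm_eq_expand_mul`) —
  the `p`-th-power part is inert under the cleaning (`PthPowerFactor.deletePthPowers_mul_of_forall_dvd`);
* §4 cleaning: a polynomial whose only `p`-th-power exponent in the support is `0` has `G − deletePthPowers p G = C (coeff 0 G)`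
  (`sub_deletePthPowers_eq_C`); for a linear power `(Xᵢ + C c)^μ`, `μ < p`: `= C (c^μ)` (`sub_deletePthPowers_linearPow`) — `0`
  for the pure factor `Xᵢ^μ` (`0 < μ`), a non-zero constant for `c ≠ 0`; and the product formula over disjoint variables
  (`sub_deletePthPowers_prod_linearFactors`).

Nothing here proves resolution of singularities in dimension ≥ 4 / characteristic `p`; counted 0; AI work, weaker than
expert review. bears_on: LADDER-RESOLUTION:D157-DOOR2 (res-dim4-pi · D3c kit E). Supports stmt-ResolutionOfSingularities-16155
(helper).
-/

set_option linter.dupNamespace false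

open MvPolynomial Finset

open scoped BigOperators

noncomputable section

namespace Summit.ResolutionOfSingularities.ResolutionOfSingularities.Theorems.PIDim4

namespace PureLeafNF

open Literature.AlgebraicGeometry.Resolution
open Literature.AlgebraicGeometry.Resolution.Hauser2010
open CentreBlowup PthPowerFactor

variable {σ : Type*} [Fintype σ] [DecidableEq σ] {K : Type*} [CommRing K]

/-! ## 1. Structure of `N(m) = ∏ᵢ ∏_c (Xᵢ + C c)^{m i c}` -/

omit [Fintype σ] [DecidableEq σ] in
/-- The monomials of a product of linear powers in `Xᵢ` involve `Xᵢ` only. [folklore] -/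
theorem apply_eq_zero_of_mem_support_linearFactors {ι : Type*} (s : Finset ι) (i : σ) (c : ι → K) (n : ι → ℕ)
    {d : σ →₀ ℕ} (hd : d ∈ (∏ t ∈ s, (X i + C (c t)) ^ n t : MvPolynomial σ K).support) {k : σ} (hk : k ≠ i) :
    d k = 0 := by
  have hre : (∏ t ∈ s, (X i + C (c t)) ^ n t : MvPolynomial σ K) =
      rename (fun _ : Unit => i) (∏ t ∈ s, (X () + C (c t)) ^ n t : MvPolynomial Unit K) := by
    rw [map_prod]
    refine Finset.prod_congr rfl fun t _ => ?_
    rw [map_pow, map_add, rename_X, rename_C]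
  by_contra hne
  rw [MvPolynomial.mem_support_iff, hre] at hd
  refine hd (coeff_rename_eq_zero _ _ _ fun u hu => ?_)
  have h0 : d k = 0 := by
    rw [← hu]
    exact Finsupp.mapDomain_notin_range u k (by rintro ⟨x, hx⟩; exact hk hx.symm)
  exact (hne h0).elim

omit [Fintype σ] in
/-- The monomials of `∏_{i∈s} (product of linear powers in Xᵢ)` vanish outside `s`. [folklore] -/
theorem apply_eq_zero_of_mem_support_prod_linearFactors {ι : Type*} (S : Finset ι) (s : Finset σ) (c : ι → K)
    (n : σ → ι → ℕ) {d : σ →₀ ℕ}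
    (hd : d ∈ (∏ i ∈ s, ∏ t ∈ S, (X i + C (c t)) ^ n i t : MvPolynomial σ K).support) {k : σ} (hk : k ∉ s) :
    d k = 0 := by
  classical
  induction s using Finset.induction_on generalizing d with
  | empty =>
    rw [Finset.prod_empty] at hd
    have : d = 0 := by
      by_contra h
      rw [MvPolynomial.mem_support_iff, ← C_1, coeff_C, if_neg (Ne.symm h)] at hd
      exact hd rfl
    rw [this, Finsupp.coe_zero, Pi.zero_apply]
  | insert j s hjs ih =>
    rw [Finset.prod_insert hjs] at hd
    obtain ⟨u, hu, v, hv, rfl⟩ := Finset.mem_add.mp (support_mul _ _ hd)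
    rw [Finsupp.add_apply, apply_eq_zero_of_mem_support_linearFactors S j c (n j) hu
      (fun h => hk (by rw [h]; exact Finset.mem_insert_self j s)),
      ih hv (fun h => hk (Finset.mem_insert_of_mem h)), add_zero]

variable (p : ℕ) [Fact p.Prime]

omit [DecidableEq σ] in
/-- **`N(m) = x^{m(·,0)} · ∏ᵢ ∏_{c ≠ 0} (Xᵢ + C c)^{m i c}`.** [folklore] -/
theorem splitForm_eq_monomial_mul (m : σ → ZMod p → ℕ) :
    (∏ i, ∏ c, (X i + C c) ^ m i c : MvPolynomial σ (ZMod p)) =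
      monomial (Finsupp.equivFunOnFinite.symm fun i => m i 0) 1 *
        ∏ i, ∏ c ∈ Finset.univ.erase 0, (X i + C c) ^ m i c := by
  have hsplit : ∀ i, (∏ c, (X i + C c) ^ m i c : MvPolynomial σ (ZMod p)) =
      X i ^ m i 0 * ∏ c ∈ Finset.univ.erase 0, (X i + C c) ^ m i c := fun i => by
    rw [← Finset.mul_prod_erase Finset.univ _ (Finset.mem_univ (0 : ZMod p)), C_0, add_zero]
  simp_rw [hsplit]
  rw [Finset.prod_mul_distrib, monomial_eq, C_1, one_mul, Finsupp.prod_fintype _ _ (fun i => pow_zero _)]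
  rfl

omit [DecidableEq σ] in
/-- The unit part `∏ᵢ ∏_{c ≠ 0} (Xᵢ + C c)^{m i c}` has constant coefficient `∏ᵢ ∏_{c ≠ 0} c^{m i c}`. [folklore] -/
theorem coeff_zero_unitPart (m : σ → ZMod p → ℕ) :
    coeff 0 (∏ i, ∏ c ∈ Finset.univ.erase 0, (X i + C c) ^ m i c : MvPolynomial σ (ZMod p)) =
      ∏ i, ∏ c ∈ Finset.univ.erase 0, c ^ m i c := by
  rw [← constantCoeff_eq, map_prod]
  refine Finset.prod_congr rfl fun i _ => ?_
  rw [map_prod]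
  refine Finset.prod_congr rfl fun c _ => ?_
  rw [map_pow, map_add, constantCoeff_X, constantCoeff_C, zero_add]

omit [DecidableEq σ] in
/-- … which is non-zero. [folklore] -/
theorem coeff_zero_unitPart_ne_zero (m : σ → ZMod p → ℕ) :
    coeff 0 (∏ i, ∏ c ∈ Finset.univ.erase 0, (X i + C c) ^ m i c : MvPolynomial σ (ZMod p)) ≠ 0 := by
  rw [coeff_zero_unitPart]
  refine Finset.prod_ne_zero_iff.mpr fun i _ => Finset.prod_ne_zero_iff.mpr fun c hc => ?_
  exact pow_ne_zero _ (Finset.ne_of_mem_erase hc)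

omit [DecidableEq σ] in
/-- **`coeff_{m(·,0)} N(m) ≠ 0`** (it is the unit part's constant coefficient). [folklore] -/
theorem coeff_corner_splitForm (m : σ → ZMod p → ℕ) :
    coeff (Finsupp.equivFunOnFinite.symm fun i => m i 0) (∏ i, ∏ c, (X i + C c) ^ m i c : MvPolynomial σ (ZMod p)) =
      ∏ i, ∏ c ∈ Finset.univ.erase 0, c ^ m i c := by
  rw [splitForm_eq_monomial_mul]
  have h := coeff_monomial_mul (0 : σ →₀ ℕ) (Finsupp.equivFunOnFinite.symm fun i => m i 0) (1 : ZMod p)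
    (∏ i, ∏ c ∈ Finset.univ.erase 0, (X i + C c) ^ m i c : MvPolynomial σ (ZMod p))
  rw [add_zero, one_mul, coeff_zero_unitPart] at h
  exact h

omit [DecidableEq σ] in
/-- **`x^{m(·,0)}` divides `N(m)` monomialwise.** [folklore] -/
theorem le_of_mem_support_splitForm (m : σ → ZMod p → ℕ) {d : σ →₀ ℕ}
    (hd : d ∈ (∏ i, ∏ c, (X i + C c) ^ m i c : MvPolynomial σ (ZMod p)).support) :
    (Finsupp.equivFunOnFinite.symm fun i => m i 0) ≤ d := by
  rw [splitForm_eq_monomial_mul, MvPolynomial.mem_support_iff, coeff_monomial_mul'] at hd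
  by_contra h
  rw [if_neg h] at hd
  exact hd rfl

omit [DecidableEq σ] in
/-- **`ord_{(x_S)} N(m) = Σ_{i∈S} m i 0`.** [folklore] -/
theorem ordAlong_splitForm (m : σ → ZMod p → ℕ) (S : Finset σ) :
    ordAlong S (∏ i, ∏ c, (X i + C c) ^ m i c : MvPolynomial σ (ZMod p)) =
      (degIn S (Finsupp.equivFunOnFinite.symm fun i => m i 0) : ℕ∞) :=
  LeafStep.ordAlong_eq_degIn S
    (⟨∏ i, ∏ c, (X i + C c) ^ m i c, Finsupp.equivFunOnFinite.symm fun i => m i 0, ∅⟩ : CState σ (ZMod p))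
    (fun _ hd => le_of_mem_support_splitForm p m hd)
    (by
      show coeff (Finsupp.equivFunOnFinite.symm fun i => m i 0)
        (∏ i, ∏ c, (X i + C c) ^ m i c : MvPolynomial σ (ZMod p)) ≠ 0
      rw [coeff_corner_splitForm]
      exact Finset.prod_ne_zero_iff.mpr fun i _ => Finset.prod_ne_zero_iff.mpr fun c hc =>
        pow_ne_zero _ (Finset.ne_of_mem_erase hc))

/-! ## 2. Translations shift the roots -/

omit [Fintype σ] [DecidableEq σ] in
/-- **A translation by an `𝔽_p`-point SHIFTS THE ROOTS**: `translate b N(m) = N(m′)`, `m′ i c = m i (c − bᵢ)`. [folklore] -/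
theorem translate_splitForm [Fintype σ] (b : σ → ZMod p) (m : σ → ZMod p → ℕ) :
    PointBlowup.translate b (∏ i, ∏ c, (X i + C c) ^ m i c : MvPolynomial σ (ZMod p)) =
      ∏ i, ∏ c, (X i + C c) ^ m i (c - b i) := by
  unfold PointBlowup.translate
  rw [map_prod]
  refine Finset.prod_congr rfl fun i _ => ?_
  rw [map_prod]
  have h1 : ∀ c, aeval (fun i => (X i + C (b i) : MvPolynomial σ (ZMod p))) ((X i + C c) ^ m i c) =
      (X i + C (c + b i)) ^ m i c := fun c => by
    rw [map_pow, map_add, aeval_X, aeval_C, map_add]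
    congr 1
    rw [algebraMap_eq]
    ring
  simp_rw [h1]
  exact Fintype.prod_equiv (Equiv.addRight (b i)) _ _ fun c => by
    simp [Equiv.addRight, add_sub_cancel_right]

/-! ## 3. Fermat: `p`-th powers of linear factors are `expand`s -/

omit [Fintype σ] [DecidableEq σ] in
/-- `(Xᵢ + C c)^p = Xᵢ^p + C c` over `𝔽_p` (freshman's dream and Fermat). [folklore] -/
theorem linear_pow_char (i : σ) (c : ZMod p) :
    ((X i + C c) ^ p : MvPolynomial σ (ZMod p)) = X i ^ p + C c := by
  rw [add_pow_char, ← map_pow, ZMod.pow_card]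

omit [Fintype σ] [DecidableEq σ] in
/-- **`(Xᵢ + C c)^{p·k} = expand p ((Xᵢ + C c)^k)`.** [folklore] -/
theorem linear_pow_mul_eq_expand (i : σ) (c : ZMod p) (k : ℕ) :
    ((X i + C c) ^ (p * k) : MvPolynomial σ (ZMod p)) = expand p ((X i + C c) ^ k) := by
  rw [pow_mul, linear_pow_char, map_pow, map_add, expand_X, expand_C]

omit [DecidableEq σ] in
/-- **`N(m) = expand p N(m / p) · N(m % p)`** (the `p`-th-power part times the residue part). [folklore] -/
theorem splitForm_eq_expand_mul (m : σ → ZMod p → ℕ) :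
    (∏ i, ∏ c, (X i + C c) ^ m i c : MvPolynomial σ (ZMod p)) =
      expand p (∏ i, ∏ c, (X i + C c) ^ (m i c / p)) * ∏ i, ∏ c, (X i + C c) ^ (m i c % p) := by
  rw [map_prod, ← Finset.prod_mul_distrib]
  refine Finset.prod_congr rfl fun i _ => ?_
  rw [map_prod, ← Finset.prod_mul_distrib]
  refine Finset.prod_congr rfl fun c _ => ?_
  rw [← linear_pow_mul_eq_expand, ← pow_add, Nat.div_add_mod]

omit [DecidableEq σ] in
omit [DecidableEq σ] in
/-- The `p`-th-power part has all exponents divisible by `p`. [folklore] -/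
theorem forall_dvd_of_mem_support_expand_splitForm (n : σ → ZMod p → ℕ) :
    ∀ u ∈ (expand p (∏ i, ∏ c, (X i + C c) ^ n i c : MvPolynomial σ (ZMod p))).support, ∀ k, p ∣ u k :=
  forall_dvd_of_mem_support_expand p _

/-! ## 4. Cleaning -/

omit [Fintype σ] in
/-- If the only `p`-th-power exponent in the support of `G` is `0`, the cleaning deletes exactly the constant term:
`G − deletePthPowers p G = C (coeff 0 G)`. [folklore] -/
theorem sub_deletePthPowers_eq_C {L : Type*} [CommRing L] (q : ℕ) (G : MvPolynomial σ L)
    (hG : ∀ d ∈ G.support, IsPthPowerExponent q d → d = 0) :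
    G - deletePthPowers q G = C (coeff 0 G) := by
  ext d
  rw [coeff_sub, coeff_deletePthPowers, coeff_C]
  by_cases hd : IsPthPowerExponent q d
  · rw [if_pos hd, sub_zero]
    by_cases hd0 : 0 = d
    · rw [if_pos hd0, hd0]
    · rw [if_neg hd0]
      by_contra hne
      exact hd0 (hG d (MvPolynomial.mem_support_iff.mpr hne) hd).symm
  · rw [if_neg hd, sub_self, if_neg]
    rintro rfl
    exact hd fun i hi => by rw [Finsupp.support_zero] at hi; exact absurd hi (Finset.notMem_empty i)

omit [Fintype σ] in
/-- The monomials of `(Xᵢ + C c)^μ` are `Xᵢ^t` with `t ≤ μ`. [folklore] -/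
theorem eq_single_of_mem_support_linearPow {L : Type*} [CommRing L] [Nontrivial L] (i : σ) (c : L) (μ : ℕ)
    {d : σ →₀ ℕ}
    (hd : d ∈ ((X i + C c) ^ μ : MvPolynomial σ L).support) : d = Finsupp.single i (d i) ∧ d i ≤ μ := by
  have hoff : ∀ k, k ≠ i → d k = 0 := fun k hk => by
    have h1 : ((X i + C c) ^ μ : MvPolynomial σ L) = ∏ t ∈ ({()} : Finset Unit), (X i + C ((fun _ => c) t)) ^ (fun _ => μ) t := by
      rw [Finset.prod_singleton]
    rw [h1] at hd
    exact apply_eq_zero_of_mem_support_linearFactors {()} i (fun _ => c) (fun _ => μ) hd hk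
  refine ⟨?_, ?_⟩
  · ext k
    by_cases hk : k = i
    · subst hk; rw [Finsupp.single_eq_same]
    · rw [Finsupp.single_eq_of_ne hk, hoff k hk]
  · have hdeg := le_totalDegree hd
    have htot : ((X i + C c) ^ μ : MvPolynomial σ L).totalDegree ≤ μ := by
      refine le_trans (totalDegree_pow _ _) ?_
      have h1 : (X i + C c : MvPolynomial σ L).totalDegree ≤ 1 :=
        le_trans (totalDegree_add _ _) (by rw [totalDegree_X, totalDegree_C]; simp)
      calc μ * (X i + C c : MvPolynomial σ L).totalDegree ≤ μ * 1 := Nat.mul_le_mul_left μ h1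
        _ = μ := mul_one μ
    have hsum : d i ≤ d.sum fun _ e => e := by
      by_cases hi : i ∈ d.support
      · exact Finset.single_le_sum (fun _ _ => Nat.zero_le _) hi
      · rw [Finsupp.notMem_support_iff.mp hi]; exact Nat.zero_le _
    omega

omit [Fintype σ] in
/-- **Cleaning a short linear power**: for `μ < q`, `(Xᵢ + C c)^μ − deletePthPowers q ((Xᵢ + C c)^μ) = C (c^μ)` — the pure
factor `Xᵢ^μ` (`c = 0 < μ`) is kept entirely, a factor with a non-zero root loses exactly its constant. [folklore] -/
theorem sub_deletePthPowers_linearPow {L : Type*} [CommRing L] [Nontrivial L] (q : ℕ) (i : σ) (c : L) {μ : ℕ}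
    (hμ : μ < q) :
    ((X i + C c) ^ μ : MvPolynomial σ L) - deletePthPowers q ((X i + C c) ^ μ) = C (c ^ μ) := by
  rw [sub_deletePthPowers_eq_C q _ (fun d hd hpth => ?_)]
  · rw [← constantCoeff_eq, map_pow, map_add, constantCoeff_X, constantCoeff_C, zero_add]
  · obtain ⟨hds, hle⟩ := eq_single_of_mem_support_linearPow i c μ hd
    have hdiv : q ∣ d i := (isPthPowerExponent_iff q d).mp hpth i
    have h0 : d i = 0 := by
      rcases hdiv with ⟨k, hk⟩
      rcases Nat.eq_zero_or_pos k with rfl | hpos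
      · simpa using hk
      · exfalso
        have : q ≤ d i := by rw [hk]; exact Nat.le_mul_of_pos_right q hpos
        omega
    rw [hds, h0, Finsupp.single_zero]

omit [Fintype σ] in
/-- **The `q`-th-power part of a product of univariate linear-factor products is the product of the parts**
(iterated `deletePthPowers_mul_disjoint`). [folklore] -/
theorem sub_deletePthPowers_prod_linearFactors {ι : Type*} (q : ℕ) (S : Finset ι) (s : Finset σ) (c : ι → K)
    (n : σ → ι → ℕ) :
    (∏ i ∈ s, ∏ t ∈ S, (X i + C (c t)) ^ n i t : MvPolynomial σ K) -
        deletePthPowers q (∏ i ∈ s, ∏ t ∈ S, (X i + C (c t)) ^ n i t) =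
      ∏ i ∈ s, ((∏ t ∈ S, (X i + C (c t)) ^ n i t : MvPolynomial σ K) -
        deletePthPowers q (∏ t ∈ S, (X i + C (c t)) ^ n i t)) := by
  classical
  induction s using Finset.induction_on with
  | empty =>
    have h0 : IsPthPowerExponent q (0 : σ →₀ ℕ) := fun i hi => by
      rw [Finsupp.support_zero] at hi; exact absurd hi (Finset.notMem_empty i)
    rw [Finset.prod_empty, Finset.prod_empty, ← C_1, ← monomial_zero', deletePthPowers_monomial,
      if_pos h0, sub_zero]
  | insert j s hjs ih =>
    rw [Finset.prod_insert hjs, Finset.prod_insert hjs, ← ih,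
      deletePthPowers_mul_disjoint q _ _ (fun u hu v hv i => ?_), sub_sub_cancel]
    by_cases hij : i = j
    · right; rw [hij]; exact apply_eq_zero_of_mem_support_prod_linearFactors S s c n hv hjs
    · left; exact apply_eq_zero_of_mem_support_linearFactors S j c (n j) hu hij

/-- **Cleaning a split form**: `N(m) − deletePthPowers p N(m) = expand p N(m/p) · ∏ᵢ (hᵢ − deletePthPowers p hᵢ)` with the
residue factors `hᵢ = ∏_c (Xᵢ + C c)^{m i c % p}`. [folklore] -/
theorem sub_deletePthPowers_splitForm (m : σ → ZMod p → ℕ) :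
    (∏ i, ∏ c, (X i + C c) ^ m i c : MvPolynomial σ (ZMod p)) -
        deletePthPowers p (∏ i, ∏ c, (X i + C c) ^ m i c) =
      expand p (∏ i, ∏ c, (X i + C c) ^ (m i c / p)) *
        ∏ i, ((∏ c, (X i + C c) ^ (m i c % p) : MvPolynomial σ (ZMod p)) -
          deletePthPowers p (∏ c, (X i + C c) ^ (m i c % p))) := by
  rw [splitForm_eq_expand_mul, deletePthPowers_mul_of_forall_dvd p _ _ (forall_dvd_of_mem_support_expand_splitForm p _),
    ← mul_sub]
  congr 1
  have h := sub_deletePthPowers_prod_linearFactors (K := ZMod p) p Finset.univ Finset.univ (fun c : ZMod p => c)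
    (fun i c => m i c % p)
  exact h

end PureLeafNF

end Summit.ResolutionOfSingularities.ResolutionOfSingularities.Theorems.PIDim4

end
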